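import Summits.QuantumFields.YangMills.Theorems.IR.ShellMaxCorrTensorisationLaw
import Summits.QuantumFields.YangMills.Theorems.IR.ShellMaxCorrTensorisationFormats
import HarnessLib

/-!
# Crux `IR` (stmt-QuantumFields-19354) — merged maxcorr line «maximal correlation at one physical thickness»:
support ENGINE (T1) «tensorisation of maximal correlation», part 2b — independent pairs, induction, the engine

Helper module for item `stmt-QuantumFields-19354` (`--supports`; it closes nothing).  Third of three files; it PROVES
the typed support statement `Tensorisation.TensorisationEngine` of the merged line's workfile
`Cruxes/IR/Lines/tensorisation_engine.lean` (ideator ym-ir-idea-1 g0, MECHANISM card §4, «the one tool that bounds a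
maximal correlation across a JOIN of σ-algebras uniformly in the number of constituents»): for finitely many
INDEPENDENT pair-algebras `mA j ⊔ mC j` of a probability space, if the Hirschfeld–Gebelein–Rényi maximal correlation
of every pair `(mA j, mC j)` is `≤ ρ`, then so is that of the joins `(⨆ j mA j, ⨆ j mC j)` — the maximum, not the sum
[Witsenhausen, *On sequences of pairs of dependent random variables*, SIAM J. Appl. Math. 28 (1975), Thm. 1; Kumar's
lemma; Polyanskiy–Wu, *Information Theory*, Thm. 33.6 (d)].  The workfile's `stub_tensorisationEngine` is
`maxCorr_tensorisation_of_measurable` below (statement literally `TensorisationEngine` unfolded); the stronger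
all-`f` operator form is `maxCorr_tensorisation`.

Route of proof (the «conditional» proof, no singular values): §4 product step — on `E × F` with `P ⊗ Q`, the
covariance bound for `(mA₁ ⊗ mA₂, mC₁ ⊗ mC₂)` from the bounds for `(mA₁, mC₁)` under `P` and `(mA₂, mC₂)` under `Q`
(part 1's `two_block`: sections + section averages); §5 two independent pairs of sub-σ-algebras of ONE space —
independence makes the law of the diagonal `ω ↦ (ω, ω)` on `(Ω × Ω, (mA₁⊔mC₁) ⊗ (mA₂⊔mC₂))` the product of the
restricted laws (`indepFun_iff_map_prod_eq_prod_map_map`), the joins are the pull-backs of the product algebras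
(`MeasurableSpace.comap_prodMk`), and part 2a transports the format both ways; §6 induction over a `Finset` of pairs
(`indep_iSup_of_disjoint`, `Finset.iSup_insert`) and conversion operator ⇔ covariance format (part 2a §2).

Status in the line: a THIRD certified radius-uniform maximal-correlation tool next to the doubling law
(`…ShellMaxCorrDoubling`) and the Dobrushin–Poincaré rung route (`…ShellMaxCorrRung`); no registered stub consumes it
(the rung `stub_shellRung` was closed without it, p596102) — banked support, census §K «JOIN ∕ TENSORISATION».

HONEST FRAMING: abstract probability (a group-blind support engine of a CONDITIONAL rung line); it proves nothing
about Yang–Mills.  `BalabanLadder.IR` is NOT proved; the Clay YM mass gap is NOT proved; R4 closes only the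
conditional finite-𝕋⁴ rung `BalabanLadder.UV`.
-/

set_option autoImplicit false

noncomputable section

open MeasureTheory ProbabilityTheory
open Literature.MathematicalPhysics.QuantumLattice

namespace Summit.QuantumFields.YangMills.Cruxes.IR.ShellMaxCorr.Tensorisation

-- sub-σ-algebras are declared BEFORE the ambient `m0`, so that instance resolution picks `m0` (Mathlib idiom)
variable {Ω : Type*} {mX mZ mA₁ mC₁ mA₂ mC₂ : MeasurableSpace Ω} {m0 : MeasurableSpace Ω} {μ : Measure Ω}

/-! ## §4 Two independent blocks: the covariance format under a product law -/

section Product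

variable {E F : Type*} {mA₁' mC₁' : MeasurableSpace E} {mE : MeasurableSpace E}
  {mA₂' mC₂' : MeasurableSpace F} {mF : MeasurableSpace F}
  {P : Measure E} {Q : Measure F} [IsProbabilityMeasure P] [IsProbabilityMeasure Q]

/-- **Product step** (the two-block lemma in σ-algebra clothes).  If `(mA₁', mC₁')` satisfy the covariance bound
under `P` and `(mA₂', mC₂')` under `Q`, then `(mA₁' ⊗ mA₂', mC₁' ⊗ mC₂')` satisfy it under `P ⊗ Q`. -/
theorem covBound_prod (hA₁ : mA₁' ≤ mE) (hC₁ : mC₁' ≤ mE) (hA₂ : mA₂' ≤ mF) (hC₂ : mC₂' ≤ mF)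
    {ρ : ℝ} (hρ : 0 ≤ ρ)
    (H₁ : ∀ a b : E → ℝ, Measurable[mA₁'] a → Measurable[mC₁'] b →
      (∃ M : ℝ, ∀ e, |a e| ≤ M) → (∃ M : ℝ, ∀ e, |b e| ≤ M) →
      |(∫ e, a e * b e ∂P) - (∫ e, a e ∂P) * (∫ e, b e ∂P)| ≤
        ρ * Real.sqrt (∫ e, (a e - ∫ e', a e' ∂P) ^ 2 ∂P) * Real.sqrt (∫ e, (b e - ∫ e', b e' ∂P) ^ 2 ∂P))
    (H₂ : ∀ a b : F → ℝ, Measurable[mA₂'] a → Measurable[mC₂'] b →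
      (∃ M : ℝ, ∀ f, |a f| ≤ M) → (∃ M : ℝ, ∀ f, |b f| ≤ M) →
      |(∫ f, a f * b f ∂Q) - (∫ f, a f ∂Q) * (∫ f, b f ∂Q)| ≤
        ρ * Real.sqrt (∫ f, (a f - ∫ f', a f' ∂Q) ^ 2 ∂Q) * Real.sqrt (∫ f, (b f - ∫ f', b f' ∂Q) ^ 2 ∂Q))
    {U V : E × F → ℝ} (hU : Measurable[mA₁'.prod mA₂'] U) (hV : Measurable[mC₁'.prod mC₂'] V)
    (hbU : ∃ M : ℝ, ∀ p, |U p| ≤ M) (hbV : ∃ M : ℝ, ∀ p, |V p| ≤ M) :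
    |(∫ p, U p * V p ∂(P.prod Q)) - (∫ p, U p ∂(P.prod Q)) * (∫ p, V p ∂(P.prod Q))| ≤
      ρ * Real.sqrt (∫ p, (U p - ∫ p', U p' ∂(P.prod Q)) ^ 2 ∂(P.prod Q))
        * Real.sqrt (∫ p, (V p - ∫ p', V p' ∂(P.prod Q)) ^ 2 ∂(P.prod Q)) := by
  obtain ⟨Mu, hMu⟩ := hbU
  obtain ⟨Mv, hMv⟩ := hbV
  -- monotonicity of product σ-algebras
  have hmono : ∀ {m₁ m₁' : MeasurableSpace E} {m₂ m₂' : MeasurableSpace F},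
      m₁ ≤ m₁' → m₂ ≤ m₂' → m₁.prod m₂ ≤ m₁'.prod m₂' :=
    fun h₁ h₂ => sup_le_sup (MeasurableSpace.comap_mono h₁) (MeasurableSpace.comap_mono h₂)
  have hU' : Measurable U := hU.mono (hmono hA₁ hA₂) le_rfl
  have hV' : Measurable V := hV.mono (hmono hC₁ hC₂) le_rfl
  refine two_block hρ hU' hV' hMu hMv (fun e => ?_) ?_
  · -- sections: the block-`F` bound
    have ha : Measurable[mA₂'] fun f => U (e, f) := hU.comp (@measurable_prodMk_left E F mA₁' mA₂' e)
    have hb : Measurable[mC₂'] fun f => V (e, f) := hV.comp (@measurable_prodMk_left E F mC₁' mC₂' e)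
    exact H₂ _ _ ha hb ⟨Mu, fun f => hMu (e, f)⟩ ⟨Mv, fun f => hMv (e, f)⟩
  · -- section averages: the block-`E` bound
    have hUa : Measurable[mA₁'.prod mF] U := hU.mono (hmono le_rfl hA₂) le_rfl
    have hVa : Measurable[mC₁'.prod mF] V := hV.mono (hmono le_rfl hC₂) le_rfl
    have ha : Measurable[mA₁'] fun e => ∫ f, U (e, f) ∂Q := @measurable_sectionAvg E F mA₁' mF Q _ U hUa
    have hb : Measurable[mC₁'] fun e => ∫ f, V (e, f) ∂Q := @measurable_sectionAvg E F mC₁' mF Q _ V hVa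
    exact H₁ _ _ ha hb ⟨|Mu|, abs_sectionAvg_le hMu⟩ ⟨|Mv|, abs_sectionAvg_le hMv⟩

end Product

/-! ## §5 Two independent pairs of sub-σ-algebras of one probability space -/

section TwoPairs

variable [IsProbabilityMeasure μ]

/-- **Independence ⇒ product law on the diagonal.**  If `mX`, `mZ` are independent under `μ`, the law of
`ω ↦ (ω, ω)` on `(Ω × Ω, mX ⊗ mZ)` is the product of the restrictions of `μ` to `mX` and to `mZ`. -/
theorem map_diag_eq_prod_of_indep (hX : mX ≤ m0) (hZ : mZ ≤ m0) (hind : Indep mX mZ μ) :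
    @Measure.map Ω (Ω × Ω) m0 (@Prod.instMeasurableSpace Ω Ω mX mZ) (fun ω => (id ω, id ω)) μ =
      @Measure.prod Ω Ω mX mZ (@Measure.map Ω Ω m0 mX id μ) (@Measure.map Ω Ω m0 mZ id μ) := by
  have hf : @Measurable Ω Ω m0 mX id := (@measurable_id Ω mX).mono hX le_rfl
  have hg : @Measurable Ω Ω m0 mZ id := (@measurable_id Ω mZ).mono hZ le_rfl
  have hind' : @IndepFun Ω Ω Ω m0 mX mZ id id μ := by
    rw [@IndepFun_iff_Indep Ω Ω Ω m0 mX mZ id id μ, MeasurableSpace.comap_id, MeasurableSpace.comap_id]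
    exact hind
  exact (indepFun_iff_map_prod_eq_prod_map_map (mβ := mX) (mβ' := mZ) (f := id) (g := id) (μ := μ)
    ⟨id, hf, ae_eq_refl _⟩ ⟨id, hg, ae_eq_refl _⟩).1 hind'

/-- **Two-pair lemma** (tensorisation over two independent pairs of sub-σ-algebras, covariance format).  If the
pair-algebras `mA₁ ⊔ mC₁` and `mA₂ ⊔ mC₂` are independent under `μ` and `|Cov| ≤ ρ σ σ` holds for `(mA₁, mC₁)` and
for `(mA₂, mC₂)`, then it holds for `(mA₁ ⊔ mA₂, mC₁ ⊔ mC₂)`. -/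
theorem covBound_sup (hA₁ : mA₁ ≤ m0) (hC₁ : mC₁ ≤ m0) (hA₂ : mA₂ ≤ m0) (hC₂ : mC₂ ≤ m0)
    (hind : Indep (mA₁ ⊔ mC₁) (mA₂ ⊔ mC₂) μ) {ρ : ℝ} (hρ : 0 ≤ ρ)
    (H₁ : ∀ u v : Ω → ℝ, Measurable[mA₁] u → Measurable[mC₁] v →
      (∃ M : ℝ, ∀ ω, |u ω| ≤ M) → (∃ M : ℝ, ∀ ω, |v ω| ≤ M) →
      |(∫ ω, u ω * v ω ∂μ) - (∫ ω, u ω ∂μ) * (∫ ω, v ω ∂μ)| ≤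
        ρ * Real.sqrt (∫ ω, (u ω - ∫ ω', u ω' ∂μ) ^ 2 ∂μ) * Real.sqrt (∫ ω, (v ω - ∫ ω', v ω' ∂μ) ^ 2 ∂μ))
    (H₂ : ∀ u v : Ω → ℝ, Measurable[mA₂] u → Measurable[mC₂] v →
      (∃ M : ℝ, ∀ ω, |u ω| ≤ M) → (∃ M : ℝ, ∀ ω, |v ω| ≤ M) →
      |(∫ ω, u ω * v ω ∂μ) - (∫ ω, u ω ∂μ) * (∫ ω, v ω ∂μ)| ≤
        ρ * Real.sqrt (∫ ω, (u ω - ∫ ω', u ω' ∂μ) ^ 2 ∂μ) * Real.sqrt (∫ ω, (v ω - ∫ ω', v ω' ∂μ) ^ 2 ∂μ))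
    {u v : Ω → ℝ} (hu : Measurable[mA₁ ⊔ mA₂] u) (hv : Measurable[mC₁ ⊔ mC₂] v)
    (hbu : ∃ M : ℝ, ∀ ω, |u ω| ≤ M) (hbv : ∃ M : ℝ, ∀ ω, |v ω| ≤ M) :
    |(∫ ω, u ω * v ω ∂μ) - (∫ ω, u ω ∂μ) * (∫ ω, v ω ∂μ)| ≤
      ρ * Real.sqrt (∫ ω, (u ω - ∫ ω', u ω' ∂μ) ^ 2 ∂μ) * Real.sqrt (∫ ω, (v ω - ∫ ω', v ω' ∂μ) ^ 2 ∂μ) := by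
  have hB₁ : mA₁ ⊔ mC₁ ≤ m0 := sup_le hA₁ hC₁
  have hB₂ : mA₂ ⊔ mC₂ ≤ m0 := sup_le hA₂ hC₂
  -- the restrictions of `μ` to the two pair-algebras, as laws of the identity map
  have hid₁ : @Measurable Ω Ω m0 (mA₁ ⊔ mC₁) id := (@measurable_id Ω (mA₁ ⊔ mC₁)).mono hB₁ le_rfl
  have hid₂ : @Measurable Ω Ω m0 (mA₂ ⊔ mC₂) id := (@measurable_id Ω (mA₂ ⊔ mC₂)).mono hB₂ le_rfl
  haveI hP : IsProbabilityMeasure (@Measure.map Ω Ω m0 (mA₁ ⊔ mC₁) id μ) :=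
    @Measure.isProbabilityMeasure_map Ω Ω m0 (mA₁ ⊔ mC₁) μ _ id ⟨id, hid₁, ae_eq_refl _⟩
  haveI hQ : IsProbabilityMeasure (@Measure.map Ω Ω m0 (mA₂ ⊔ mC₂) id μ) :=
    @Measure.isProbabilityMeasure_map Ω Ω m0 (mA₂ ⊔ mC₂) μ _ id ⟨id, hid₂, ae_eq_refl _⟩
  -- the pair bounds under the restricted laws (forward transport along `id`)
  have H₁' := fun (a b : Ω → ℝ) (ha : Measurable[mA₁] a) (hb : Measurable[mC₁] b)
      (hba : ∃ M : ℝ, ∀ x, |a x| ≤ M) (hbb : ∃ M : ℝ, ∀ x, |b x| ≤ M) =>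
    covBound_map_of_comap (μ := μ) (β := Ω) (mX' := mA₁) (mZ' := mC₁) (mβ := mA₁ ⊔ mC₁) (φ := id)
      hid₁ le_sup_left le_sup_right (ρ := ρ)
      (fun u v hu hv hbu hbv => H₁ u v (by rwa [MeasurableSpace.comap_id] at hu)
        (by rwa [MeasurableSpace.comap_id] at hv) hbu hbv) ha hb hba hbb
  have H₂' := fun (a b : Ω → ℝ) (ha : Measurable[mA₂] a) (hb : Measurable[mC₂] b)
      (hba : ∃ M : ℝ, ∀ x, |a x| ≤ M) (hbb : ∃ M : ℝ, ∀ x, |b x| ≤ M) =>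
    covBound_map_of_comap (μ := μ) (β := Ω) (mX' := mA₂) (mZ' := mC₂) (mβ := mA₂ ⊔ mC₂) (φ := id)
      hid₂ le_sup_left le_sup_right (ρ := ρ)
      (fun u v hu hv hbu hbv => H₂ u v (by rwa [MeasurableSpace.comap_id] at hu)
        (by rwa [MeasurableSpace.comap_id] at hv) hbu hbv) ha hb hba hbb
  -- the product bound under `P ⊗ Q`
  have HP := fun (U V : Ω × Ω → ℝ) (hU : Measurable[mA₁.prod mA₂] U) (hV : Measurable[mC₁.prod mC₂] V)
      (hbU : ∃ M : ℝ, ∀ p, |U p| ≤ M) (hbV : ∃ M : ℝ, ∀ p, |V p| ≤ M) =>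
    covBound_prod (E := Ω) (F := Ω) (mA₁' := mA₁) (mC₁' := mC₁) (mE := mA₁ ⊔ mC₁)
      (mA₂' := mA₂) (mC₂' := mC₂) (mF := mA₂ ⊔ mC₂)
      (P := @Measure.map Ω Ω m0 (mA₁ ⊔ mC₁) id μ) (Q := @Measure.map Ω Ω m0 (mA₂ ⊔ mC₂) id μ)
      le_sup_left le_sup_right le_sup_left le_sup_right hρ H₁' H₂' hU hV hbU hbV
  -- independence: the diagonal law is the product law
  have hlaw := map_diag_eq_prod_of_indep (μ := μ) hB₁ hB₂ hind
  have hΔ : @Measurable Ω (Ω × Ω) m0 (@Prod.instMeasurableSpace Ω Ω (mA₁ ⊔ mC₁) (mA₂ ⊔ mC₂))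
      (fun ω => (id ω, id ω)) := hid₁.prodMk hid₂
  -- monotonicity of product σ-algebras
  have hmono : ∀ {m₁ m₁' m₂ m₂' : MeasurableSpace Ω}, m₁ ≤ m₁' → m₂ ≤ m₂' → m₁.prod m₂ ≤ m₁'.prod m₂' :=
    fun h₁ h₂ => sup_le_sup (MeasurableSpace.comap_mono h₁) (MeasurableSpace.comap_mono h₂)
  -- the joins are the pull-backs of the product algebras along the diagonal
  have hcA : (mA₁.prod mA₂).comap (fun ω : Ω => (id ω, id ω)) = mA₁ ⊔ mA₂ := by
    rw [MeasurableSpace.comap_prodMk, MeasurableSpace.comap_id, MeasurableSpace.comap_id]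
  have hcC : (mC₁.prod mC₂).comap (fun ω : Ω => (id ω, id ω)) = mC₁ ⊔ mC₂ := by
    rw [MeasurableSpace.comap_prodMk, MeasurableSpace.comap_id, MeasurableSpace.comap_id]
  -- backward transport along the diagonal
  exact covBound_comap_of_map (μ := μ) (β := Ω × Ω) (mX' := mA₁.prod mA₂) (mZ' := mC₁.prod mC₂)
    (mβ := @Prod.instMeasurableSpace Ω Ω (mA₁ ⊔ mC₁) (mA₂ ⊔ mC₂)) (φ := fun ω => (id ω, id ω)) hΔ
    (hmono le_sup_left le_sup_left) (hmono le_sup_right le_sup_right) (ρ := ρ)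
    (fun U V hU hV hbU hbV => by rw [hlaw]; exact HP U V hU hV hbU hbV)
    (by rw [hcA]; exact hu) (by rw [hcC]; exact hv) hbu hbv

end TwoPairs

/-! ## §6 Induction over finitely many independent pairs; the engine in operator format -/

section Induction

variable [IsProbabilityMeasure μ]

/-- **Tensorisation over a finite set of independent pairs (covariance format).**  For pair-algebras
`mA j ⊔ mC j` independent under `μ` with `|Cov| ≤ ρ σ σ` for every pair `(mA j, mC j)`, the bound holds for
`(⨆_{j∈s} mA j, ⨆_{j∈s} mC j)` — uniformly in the number of pairs. -/
theorem covBound_biSup {J : Type*} (mA mC : J → MeasurableSpace Ω) (hA : ∀ j, mA j ≤ m0) (hC : ∀ j, mC j ≤ m0)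
    (hind : iIndep (fun j => mA j ⊔ mC j) μ) {ρ : ℝ} (hρ : 0 ≤ ρ)
    (H : ∀ j, ∀ u v : Ω → ℝ, Measurable[mA j] u → Measurable[mC j] v →
      (∃ M : ℝ, ∀ ω, |u ω| ≤ M) → (∃ M : ℝ, ∀ ω, |v ω| ≤ M) →
      |(∫ ω, u ω * v ω ∂μ) - (∫ ω, u ω ∂μ) * (∫ ω, v ω ∂μ)| ≤
        ρ * Real.sqrt (∫ ω, (u ω - ∫ ω', u ω' ∂μ) ^ 2 ∂μ) * Real.sqrt (∫ ω, (v ω - ∫ ω', v ω' ∂μ) ^ 2 ∂μ))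
    (s : Finset J) :
    ∀ u v : Ω → ℝ, Measurable[⨆ j ∈ s, mA j] u → Measurable[⨆ j ∈ s, mC j] v →
      (∃ M : ℝ, ∀ ω, |u ω| ≤ M) → (∃ M : ℝ, ∀ ω, |v ω| ≤ M) →
      |(∫ ω, u ω * v ω ∂μ) - (∫ ω, u ω ∂μ) * (∫ ω, v ω ∂μ)| ≤
        ρ * Real.sqrt (∫ ω, (u ω - ∫ ω', u ω' ∂μ) ^ 2 ∂μ) * Real.sqrt (∫ ω, (v ω - ∫ ω', v ω' ∂μ) ^ 2 ∂μ) := by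
  classical
  refine Finset.induction_on s ?_ ?_
  · -- no pair: both joins are the trivial algebra
    intro u v hu _ _ _
    have hu' : Measurable[⊥] u := by
      have e : (⨆ j ∈ (∅ : Finset J), mA j) = ⊥ := by simp
      rwa [e] at hu
    exact cov_le_of_measurable_bot hρ hu' v
  · -- add one pair
    intro j₀ s hj ih u v hu hv hbu hbv
    rw [Finset.iSup_insert] at hu hv
    have hle : ∀ j, mA j ⊔ mC j ≤ m0 := fun j => sup_le (hA j) (hC j)
    have hdisj : Disjoint ({j₀} : Set J) (↑s : Set J) := by
      rw [Set.disjoint_singleton_left]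
      exact fun h => hj (Finset.mem_coe.1 h)
    have hI := indep_iSup_of_disjoint (m := fun j => mA j ⊔ mC j) hle hind hdisj
    rw [iSup_singleton] at hI
    have hind' : Indep (mA j₀ ⊔ mC j₀) ((⨆ j ∈ s, mA j) ⊔ ⨆ j ∈ s, mC j) μ :=
      indep_of_indep_of_le_right hI
        (sup_le (iSup₂_mono fun j _ => le_sup_left) (iSup₂_mono fun j _ => le_sup_right))
    exact covBound_sup (μ := μ) (mA₁ := mA j₀) (mC₁ := mC j₀) (mA₂ := ⨆ j ∈ s, mA j) (mC₂ := ⨆ j ∈ s, mC j)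
      (hA j₀) (hC j₀) (iSup₂_le fun j _ => hA j) (iSup₂_le fun j _ => hC j) hind' hρ (H j₀)
      (ih) hu hv hbu hbv

end Induction

/-- **ENGINE (T1): tensorisation of maximal correlation** (Witsenhausen 1975, Thm. 1 / Kumar's lemma, σ-algebra
operator format) — the statement `Tensorisation.TensorisationEngine` of the merged line's workfile
`Cruxes/IR/Lines/tensorisation_engine.lean`, unfolded verbatim (same binder order; the workfile's
`stub_tensorisationEngine` is `maxCorr_tensorisation`).  For finitely many INDEPENDENT pair-algebras `mA j ⊔ mC j` of a
probability space with `‖P_{mA j} P_{mC j} f − 𝔼f‖₂ ≤ ρ ‖f − 𝔼f‖₂` for every pair, the joins satisfy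
`‖P_{⨆ mA} P_{⨆ mC} f − 𝔼f‖₂ ≤ ρ ‖f − 𝔼f‖₂` — uniformly in the number of pairs (no union bound).  Proof:
operator ⇒ covariance format per pair (§2), induction over the pairs with the two-pair lemma (§5: diagonal
pushforward + the two-block Fubini lemma of part 1 + Doob–Dynkin), covariance ⇒ operator format (§2).  Abstract
probability; proves nothing about Yang–Mills. -/
theorem maxCorr_tensorisation : ∀ (Ω : Type) [MeasurableSpace Ω] (μ : Measure Ω) [IsProbabilityMeasure μ]
    (J : Type) [Fintype J] (mA mC : J → MeasurableSpace Ω),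
    (∀ j, mA j ≤ ‹MeasurableSpace Ω›) → (∀ j, mC j ≤ ‹MeasurableSpace Ω›) →
    iIndep (fun j => mA j ⊔ mC j) μ →
    ∀ ρ : ℝ, 0 ≤ ρ →
    (∀ j, ∀ f : Ω → ℝ, Measurable f → (∃ M : ℝ, ∀ ω, |f ω| ≤ M) →
      ∫ ω, ((μ[μ[f|mC j]|mA j]) ω - ∫ ω', f ω' ∂μ) ^ 2 ∂μ ≤
        ρ ^ 2 * ∫ ω, (f ω - ∫ ω', f ω' ∂μ) ^ 2 ∂μ) →
    ∀ f : Ω → ℝ, Measurable f → (∃ M : ℝ, ∀ ω, |f ω| ≤ M) →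
      ∫ ω, ((μ[μ[f|⨆ j, mC j]|⨆ j, mA j]) ω - ∫ ω', f ω' ∂μ) ^ 2 ∂μ ≤
        ρ ^ 2 * ∫ ω, (f ω - ∫ ω', f ω' ∂μ) ^ 2 ∂μ := by
  intro Ω mΩ μ _ J _ mA mC hA hC hind ρ hρ H f hf hbf
  obtain ⟨M, hM⟩ := hbf
  -- each pair in covariance format
  have Hc : ∀ j, ∀ u v : Ω → ℝ, Measurable[mA j] u → Measurable[mC j] v →
      (∃ M : ℝ, ∀ ω, |u ω| ≤ M) → (∃ M : ℝ, ∀ ω, |v ω| ≤ M) →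
      |(∫ ω, u ω * v ω ∂μ) - (∫ ω, u ω ∂μ) * (∫ ω, v ω ∂μ)| ≤
        ρ * Real.sqrt (∫ ω, (u ω - ∫ ω', u ω' ∂μ) ^ 2 ∂μ) * Real.sqrt (∫ ω, (v ω - ∫ ω', v ω' ∂μ) ^ 2 ∂μ) :=
    fun j u v hu hv hbu hbv => by
      obtain ⟨Mu, hMu⟩ := hbu
      obtain ⟨Mv, hMv⟩ := hbv
      exact cov_le_of_opBound (μ := μ) (hA j) (hC j) hρ (fun g hg hbg => H j g (hg.mono (hC j) le_rfl) hbg)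
        hu hv hMu hMv
  -- the joins in covariance format
  have Hs := covBound_biSup (μ := μ) mA mC hA hC hind hρ Hc Finset.univ
  have eA : (⨆ j ∈ (Finset.univ : Finset J), mA j) = ⨆ j, mA j := by simp
  have eC : (⨆ j ∈ (Finset.univ : Finset J), mC j) = ⨆ j, mC j := by simp
  rw [eA, eC] at Hs
  -- back to the operator format
  exact opBound_of_cov_le (μ := μ) (iSup_le hA) (iSup_le hC) hρ Hs hf hM

/-- **ENGINE (T1), workfile form** — LITERALLY the statement `Tensorisation.TensorisationEngine` of
`Cruxes/IR/Lines/tensorisation_engine.lean` unfolded (its `stub_tensorisationEngine` is this theorem).  Elaboration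
note: in the workfile's `MaxCorrLE μ mX mZ ρ` the hypothesis `Measurable f` is elaborated against the binder `mZ`
(the last `MeasurableSpace Ω` in scope), so the format quantifies over bounded `mZ`-MEASURABLE `f` — for which
`P_Z f = f`, i.e. it is the standard form «`‖P_X g − 𝔼g‖₂ ≤ ρ ‖g − 𝔼g‖₂` on `L²(mZ)`» of maximal correlation `≤ ρ`;
hypotheses and conclusion are both of this form here.  Derived from the general `maxCorr_tensorisation` route:
the per-pair hypothesis in this weaker form still gives the covariance format (`cov_le_of_opBound`), and the
conclusion for all bounded measurable `f` specialises to `(⨆ j, mC j)`-measurable `f`. -/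
theorem maxCorr_tensorisation_of_measurable : ∀ (Ω : Type) [MeasurableSpace Ω] (μ : Measure Ω)
    [IsProbabilityMeasure μ] (J : Type) [Fintype J] (mA mC : J → MeasurableSpace Ω),
    (∀ j, mA j ≤ ‹MeasurableSpace Ω›) → (∀ j, mC j ≤ ‹MeasurableSpace Ω›) →
    iIndep (fun j => mA j ⊔ mC j) μ →
    ∀ ρ : ℝ, 0 ≤ ρ →
    (∀ j, ∀ f : Ω → ℝ, Measurable[mC j] f → (∃ M : ℝ, ∀ ω, |f ω| ≤ M) →
      ∫ ω, ((μ[μ[f|mC j]|mA j]) ω - ∫ ω', f ω' ∂μ) ^ 2 ∂μ ≤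
        ρ ^ 2 * ∫ ω, (f ω - ∫ ω', f ω' ∂μ) ^ 2 ∂μ) →
    ∀ f : Ω → ℝ, Measurable[⨆ j, mC j] f → (∃ M : ℝ, ∀ ω, |f ω| ≤ M) →
      ∫ ω, ((μ[μ[f|⨆ j, mC j]|⨆ j, mA j]) ω - ∫ ω', f ω' ∂μ) ^ 2 ∂μ ≤
        ρ ^ 2 * ∫ ω, (f ω - ∫ ω', f ω' ∂μ) ^ 2 ∂μ := by
  intro Ω mΩ μ _ J _ mA mC hA hC hind ρ hρ H f hf hbf
  obtain ⟨M, hM⟩ := hbf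
  have Hc : ∀ j, ∀ u v : Ω → ℝ, Measurable[mA j] u → Measurable[mC j] v →
      (∃ M : ℝ, ∀ ω, |u ω| ≤ M) → (∃ M : ℝ, ∀ ω, |v ω| ≤ M) →
      |(∫ ω, u ω * v ω ∂μ) - (∫ ω, u ω ∂μ) * (∫ ω, v ω ∂μ)| ≤
        ρ * Real.sqrt (∫ ω, (u ω - ∫ ω', u ω' ∂μ) ^ 2 ∂μ) * Real.sqrt (∫ ω, (v ω - ∫ ω', v ω' ∂μ) ^ 2 ∂μ) :=
    fun j u v hu hv hbu hbv => by
      obtain ⟨Mu, hMu⟩ := hbu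
      obtain ⟨Mv, hMv⟩ := hbv
      exact cov_le_of_opBound (μ := μ) (hA j) (hC j) hρ (H j) hu hv hMu hMv
  have Hs := covBound_biSup (μ := μ) mA mC hA hC hind hρ Hc Finset.univ
  have eA : (⨆ j ∈ (Finset.univ : Finset J), mA j) = ⨆ j, mA j := by simp
  have eC : (⨆ j ∈ (Finset.univ : Finset J), mC j) = ⨆ j, mC j := by simp
  rw [eA, eC] at Hs
  exact opBound_of_cov_le (μ := μ) (iSup_le hA) (iSup_le hC) hρ Hs (hf.mono (iSup_le hC) le_rfl) hM

end Summit.QuantumFields.YangMills.Cruxes.IR.ShellMaxCorr.Tensorisation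

end
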